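import Mathlib

/-!
# STUB-IDEAS k3 (gen 12) — `stub_heegnerIndexLowerAtTwo` · crux stmt-BirchSwinnertonDyer-27851 (`PrintCf2.SplitBadTwoLowerHalfOfFacts`)
# TECHNIQUE «decomposition» × FAMILY 3 «autopsy / minimal counterexample»:
# the anchor package `Δ₀(W₀) ≤ 1` of arm M′ is STRUCT ∧ EXHIBIT — and the v2.8 shortcut «dim ≤ 1 ⟹ cyclic ⟹ φ₀ = 0» (R90 / R93 (b)) is FALSE

Seat `planner-sidea-stub_heegnerIndexLowerAtTwo-3-g12-0` (stub-ideation, k = 3, gen 12). Typed sketch accompanying the card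
`Ideas/stub_heegnerIndexLowerAtTwo-k3.md` (gate slug `stub-heegnerindexloweratwo-k3-g12`). HONEST FRAMING: nothing here closes the
crux, the stub or any registered item; BSD is NOT proved by any of this; no summit statement is proved. `import Mathlib` only; no
`sorry`, no new `instance`, no `notation`, no named fact.

## What is certified here

* §A  MECHANISM (any commutative domain `Λ`, in particular `Λ = ℤ₂⟦T⟧ = IwasawaAlgebra 2`): multiplication by `f ≠ 0` embeds
  `Λ ⧸ 𝔞` `Λ`-linearly into the CYCLIC module `Λ ⧸ (f)·𝔞` (`mulQuot_injective`); hence whenever `Λ ⧸ 𝔞` is finite and non-zero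
  (`𝔞` a proper ideal of finite colength, e.g. `𝔞 = 𝔪 = (2, T)`), the cyclic torsion module `X = Λ ⧸ (f)·𝔞` — one generator,
  `dim X/𝔪X = 1` — HAS a non-zero finite `Λ`-submodule (`exists_finite_submodule_ne_bot`). So «f.g. torsion `Λ`-module with
  `dim_{𝔽₂} X/𝔪X ≤ 1` ⟹ no non-zero finite submodule» (STUB-PLAN v2.8 R93 (b), the lever of R90's CYC(784)) is false; the true
  statement is «cyclic torsion `Λ ⧸ I` has no non-zero finite submodule ⟺ `I` is principal ⟺ `pd_Λ (Λ ⧸ I) ≤ 1`»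
  (Jannsen; Wake–Wang-Erickson Lemma 2.2.2 «type 1 ⟺ torsion and no non-zero finite submodule»), of which Greenberg's
  «`Λ/(f)` has no non-zero finite submodule» (LNM 1716 p. 127) is the principal case ONLY.
* §B  THE DECIDABLE SHADOW at the anchor's shape: `X₁ = ℤ e ⊕ 𝔽₂ ε`, `T e = −2e + ε`, `T ε = 0` — the `ℤ`-structure of
  `Λ ⧸ (T+2)𝔪` (`e ↦ 1`, `ε ↦ T+2`). Kernel-checked: cyclic (`shadow_cyclic`), killed by `(T+2)²` (`shadow_torsion`), control
  quotient `X₁/TX₁` cyclic of order 4 (`shadow_four_mul_mem_range`, `shadow_two_not_mem_range`), residual dimension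
  `dim X₁/(2,T)X₁ = 1` (`shadow_residual_ker`), AND a non-zero finite `T`-stable subgroup `F₁ = 𝔽₂ ε` (`F₁_stable`, `F₁_ne_bot`,
  `finite_F₁`) with `X₁[T] ⊇ F₁ ≠ 0` (`shadow_ker_ne_bot`) — i.e. the digit `φ₀ = v₂ #X^Γ` is `1`, not `0`.
* §C  THE TWIN: `X₂ = ℤ`, `T = ·(−4)` (shadow of `Λ ⧸ (T+4)`): the SAME level-0 data — cyclic, `X₂/TX₂` of order 4, residual
  dimension 1, `λ = 1`, `μ = 0` — but NO non-zero finite subgroup (`twin_noFinite`) and `X₂[T] = 0` (`twin_ker_eq_bot`): `φ₀ = 0`.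
  Conclusion: `φ₀(W₀)` is NOT a function of any `K₀`-level descent datum (bottom dimension, cokernel rank, `#X/TX`); it is decided
  only together with the characteristic series (L-value input — what arm M′ is calibrating) or by global duality (Greenberg 2016
  Prop. 4.1.1, tree named fact `Greenberg2016.prop411_selmer_isAlmostDivisible`, case (c)).
* §D  THE RE-CUT (pure `ℤ` bookkeeping in the variables of k1-g10 `armM_member_bound` / the critic's `StubPlanT3ArmMPrimeCalibration`):
  `Δ₀ = φ₀ + kk₀ + β₀ + κ₀ ≤ 1` follows from the STRUCTURAL digit `φ₀ = 0`, the landed `kk₀ = 0`, and CONSTRUCTIVE LOWER bounds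
  `b⁻ ≤ b₀`, `c⁻ ≤ c₀` on the anchor's bottom / cokernel digits filling the member tables up to one digit
  (`delta0_le_one_of_struct_exhibit`, `delta0_eq_zero_of_struct_exhibit`); exhibited independent classes turn into digits by
  `le_padicValNat_card_of_injective`, `add_le_padicValNat_card_of_disjoint`. NO UPPER-BOUND DESCENT at `W₀` is consumed anywhere.

References: [GreenbergLNM1716] §4 pp. 124–127 (Props. 4.14–4.15 and the `Λ/(f)` fact); [Greenberg2016Selmer] Prop. 4.1.1;
[Jannsen1989IwasawaModules] §2; [WakeWangErickson2017] Lemma 2.2.2 (arXiv:1510.01661 p. 6); [Agboola2007] §§5–6, Prop. 8.1.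
-/

set_option autoImplicit false
set_option linter.dupNamespace false

namespace Summit.BirchSwinnertonDyer.BirchSwinnertonDyer.Cruxes.SplitBadTwoLowerHalfOfFacts.StubIdeasK3G12

/-! ## §A. The mechanism: `Λ ⧸ 𝔞 ↪ Λ ⧸ (f)·𝔞` for every non-zero-divisor `f` -/

section Mechanism

variable {Λ : Type*} [CommRing Λ]

/-- Multiplication by `f` as a `Λ`-linear map `Λ ⧸ 𝔞 → Λ ⧸ (f)·𝔞` (well defined: `f·𝔞 ⊆ (f)·𝔞`). [folklore] -/
def mulQuot (f : Λ) (𝔞 : Ideal Λ) : (Λ ⧸ 𝔞) →ₗ[Λ] (Λ ⧸ (Ideal.span {f} * 𝔞)) :=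
  Submodule.mapQ 𝔞 (Ideal.span {f} * 𝔞) (LinearMap.lsmul Λ Λ f) (fun x hx ↦ by
    simpa only [Submodule.mem_comap, LinearMap.lsmul_apply, smul_eq_mul] using
      Ideal.mul_mem_mul (Ideal.mem_span_singleton_self f) hx)

theorem mulQuot_mk (f : Λ) (𝔞 : Ideal Λ) (a : Λ) :
    mulQuot f 𝔞 (Ideal.Quotient.mk 𝔞 a) = Ideal.Quotient.mk (Ideal.span {f} * 𝔞) (f * a) := rfl

/-- **`Λ ⧸ 𝔞 ↪ Λ ⧸ (f)·𝔞`** for `f ≠ 0` in a domain: `f a ∈ (f)𝔞 ⟹ f a = f z` with `z ∈ 𝔞` `⟹ a = z`. [folklore] -/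
theorem mulQuot_injective [IsDomain Λ] {f : Λ} (hf : f ≠ 0) (𝔞 : Ideal Λ) :
    Function.Injective (mulQuot f 𝔞) := by
  intro x y hxy
  obtain ⟨a, rfl⟩ := Ideal.Quotient.mk_surjective x
  obtain ⟨b, rfl⟩ := Ideal.Quotient.mk_surjective y
  rw [Ideal.Quotient.eq]
  rw [mulQuot_mk, mulQuot_mk, Ideal.Quotient.eq, ← mul_sub, Ideal.mem_span_singleton_mul] at hxy
  obtain ⟨z, hz, hfz⟩ := hxy
  have hzab : z = a - b := mul_left_cancel₀ hf hfz
  exact hzab ▸ hz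

/-- Every quotient `Λ ⧸ I` is CYCLIC: generated by the class of `1` (so `dim X/𝔪X ≤ 1` for local `Λ`). [folklore] -/
theorem quot_cyclic (I : Ideal Λ) (x : Λ ⧸ I) : ∃ a : Λ, x = a • Ideal.Quotient.mk I 1 := by
  obtain ⟨a, rfl⟩ := Ideal.Quotient.mk_surjective x
  refine ⟨a, ?_⟩
  show Submodule.Quotient.mk a = a • Submodule.Quotient.mk (1 : Λ)
  rw [← Submodule.Quotient.mk_smul, smul_eq_mul, mul_one]

/-- **The cyclic module `Λ ⧸ (f)·𝔞` has a NON-ZERO FINITE submodule** as soon as `Λ ⧸ 𝔞` is finite and non-trivial (`𝔞` proper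
of finite colength — over `Λ = ℤ₂⟦T⟧`: any `𝔪`-primary `𝔞 ≠ Λ`, e.g. `𝔞 = 𝔪`, `f = T + 2`). Refutes «cyclic (f.g. torsion,
`dim X/𝔪X ≤ 1`) ⟹ no non-zero finite submodule» (STUB-PLAN v2.8 R93 (b) / R90). [folklore; cf. GreenbergLNM1716 p. 127 for `𝔞 = Λ`] -/
theorem exists_finite_submodule_ne_bot [IsDomain Λ] {f : Λ} (hf : f ≠ 0) (𝔞 : Ideal Λ)
    [Finite (Λ ⧸ 𝔞)] [Nontrivial (Λ ⧸ 𝔞)] :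
    ∃ N : Submodule Λ (Λ ⧸ (Ideal.span {f} * 𝔞)), N ≠ ⊥ ∧ Finite N := by
  refine ⟨LinearMap.range (mulQuot f 𝔞), fun h ↦ ?_,
    Finite.of_surjective _ (LinearMap.surjective_rangeRestrict (mulQuot f 𝔞))⟩
  obtain ⟨x, hx⟩ := exists_ne (0 : Λ ⧸ 𝔞)
  have hmem : mulQuot f 𝔞 x ∈ LinearMap.range (mulQuot f 𝔞) := LinearMap.mem_range_self _ x
  rw [h, Submodule.mem_bot] at hmem
  exact hx (mulQuot_injective hf 𝔞 (by rw [hmem, map_zero]))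

end Mechanism

/-! ## §B. The decidable shadow of `Λ ⧸ (T+2)𝔪`: `X₁ = ℤ × ZMod 2`, `T (a, b) = (−2a, a mod 2)` -/

section Shadow

private theorem zmod2_two : (2 : ZMod 2) = 0 := by decide

private theorem two_nsmul_zmod2 (b : ZMod 2) : 2 • b = 0 := by
  fin_cases b <;> decide

/-- `T` on the shadow: `T e = −2e + ε`, `T ε = 0` in the basis `e = (1,0)`, `ε = (0,1)`. [this sketch] -/
def T₁ : ℤ × ZMod 2 →+ ℤ × ZMod 2 :=
  AddMonoidHom.mk' (fun x ↦ (-2 * x.1, (x.1 : ZMod 2))) (by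
    intro x y
    ext <;> simp [mul_add, Int.cast_add])

@[simp] theorem T₁_apply (a : ℤ) (b : ZMod 2) : T₁ (a, b) = (-2 * a, (a : ZMod 2)) := rfl

/-- CYCLIC: every element is `a·e + b·Te` (`e = (1,0)`), i.e. `X₁ = ℤ[T]·e`, `dim X₁/𝔪X₁ = 1`. [this sketch] -/
theorem shadow_cyclic (x : ℤ × ZMod 2) :
    ∃ a b : ℤ, x = (a • ((1 : ℤ), (0 : ZMod 2)) + b • T₁ (1, 0)) := by
  obtain ⟨x₁, x₂⟩ := x
  refine ⟨x₁ + 2 * (x₂.val : ℤ), x₂.val, ?_⟩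
  rw [T₁_apply]
  ext
  · simp only [Prod.smul_mk, Prod.mk_add_mk, smul_eq_mul]
    ring
  · simp only [Prod.smul_mk, Prod.mk_add_mk, smul_zero, zero_add, Int.cast_one, zsmul_eq_mul, mul_one,
      Int.cast_natCast, ZMod.natCast_zmod_val]

/-- `(T + 2)·(a, b) = (0, a mod 2)`. [this sketch] -/
theorem shadow_T_add_two_apply (a : ℤ) (b : ZMod 2) : T₁ (a, b) + 2 • (a, b) = (0, (a : ZMod 2)) := by
  ext
  · simp only [T₁_apply, Prod.smul_mk, Prod.mk_add_mk, nsmul_eq_mul, Nat.cast_ofNat]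
    ring
  · simp only [T₁_apply, Prod.smul_mk, Prod.mk_add_mk, two_nsmul_zmod2, add_zero]

/-- TORSION: `(T + 2)² = 0` on `X₁` (characteristic ideal `(T+2)`, `λ = 1`, `μ = 0`). [this sketch] -/
theorem shadow_torsion (x : ℤ × ZMod 2) :
    T₁ (T₁ x + 2 • x) + 2 • (T₁ x + 2 • x) = 0 := by
  obtain ⟨a, b⟩ := x
  rw [shadow_T_add_two_apply a b, shadow_T_add_two_apply 0 (a : ZMod 2)]
  simp

/-- CONTROL IS FINITE: `4·X₁ ⊆ T X₁` … [this sketch] -/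
theorem shadow_four_mul_mem_range (a : ℤ) : ((4 * a : ℤ), (0 : ZMod 2)) ∈ T₁.range := by
  refine ⟨(-2 * a, 0), ?_⟩
  rw [T₁_apply]
  ext
  · simp only
    ring
  · simp only [Int.cast_mul, Int.cast_neg, Int.cast_ofNat, zmod2_two, neg_zero, zero_mul]

theorem shadow_four_nsmul_eq (a : ℤ) (b : ZMod 2) : 4 • ((a, b) : ℤ × ZMod 2) = (4 * a, 0) := by
  ext
  · simp only [Prod.smul_mk, nsmul_eq_mul, Nat.cast_ofNat]
  · simp only [Prod.smul_mk]
    fin_cases b <;> decide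

/-- … and `2e ∉ T X₁`: with `shadow_cyclic` the control quotient `X₁/TX₁` is cyclic of order EXACTLY `4` (`= ℤ/4`). [this sketch] -/
theorem shadow_two_not_mem_range : ((2 : ℤ), (0 : ZMod 2)) ∉ T₁.range := by
  rintro ⟨⟨c, d⟩, h⟩
  rw [T₁_apply, Prod.mk.injEq] at h
  obtain ⟨h1, h2⟩ := h
  have hc : c = -1 := by omega
  subst hc
  exact absurd h2 (by decide)

/-- RESIDUAL DIMENSION ONE: the reduction `r (a, b) = a mod 2` is onto `𝔽₂` and kills exactly `2X₁ + TX₁ = 𝔪X₁`, so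
`X₁/𝔪X₁ ≅ 𝔽₂` — the «dim ≤ 1» R90 proposes to certify by descent holds here. [this sketch] -/
def r₁ : ℤ × ZMod 2 →+ ZMod 2 := (Int.castAddHom (ZMod 2)).comp (AddMonoidHom.fst ℤ (ZMod 2))

@[simp] theorem r₁_apply (a : ℤ) (b : ZMod 2) : r₁ (a, b) = (a : ZMod 2) := rfl

theorem r₁_surjective : Function.Surjective r₁ := fun y ↦ ⟨((y.val : ℤ), 0), by simp⟩

theorem shadow_residual_ker (x : ℤ × ZMod 2) :
    r₁ x = 0 ↔ ∃ y z : ℤ × ZMod 2, x = 2 • y + T₁ z := by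
  obtain ⟨a, b⟩ := x
  constructor
  · intro h
    rw [r₁_apply, ZMod.intCast_zmod_eq_zero_iff_dvd] at h
    obtain ⟨a', ha'⟩ := h
    refine ⟨(a' + (b.val : ℤ), 0), ((b.val : ℤ), 0), ?_⟩
    rw [T₁_apply]
    ext
    · simp only [Prod.smul_mk, Prod.mk_add_mk, nsmul_eq_mul, Nat.cast_ofNat]
      omega
    · simp only [Prod.smul_mk, Prod.mk_add_mk, smul_zero, zero_add, Int.cast_natCast, ZMod.natCast_zmod_val]
  · rintro ⟨⟨y₁, y₂⟩, ⟨z₁, z₂⟩, h⟩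
    rw [T₁_apply, Prod.smul_mk, Prod.mk_add_mk, Prod.mk.injEq] at h
    obtain ⟨h1, -⟩ := h
    simp only [nsmul_eq_mul, Nat.cast_ofNat] at h1
    rw [r₁_apply, h1, ZMod.intCast_zmod_eq_zero_iff_dvd]
    exact ⟨y₁ - z₁, by ring⟩

/-- THE FINITE SUBMODULE: `F₁ = 𝔽₂ ε = {0} × ZMod 2` (the image of `Λ/𝔪` under `mulQuot (T+2) 𝔪`). [this sketch] -/
def F₁ : AddSubgroup (ℤ × ZMod 2) := (AddMonoidHom.fst ℤ (ZMod 2)).ker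

theorem mem_F₁ (x : ℤ × ZMod 2) : x ∈ F₁ ↔ x.1 = 0 := AddMonoidHom.mem_ker

/-- `F₁` is `T`-stable (indeed `T F₁ = 0`). [this sketch] -/
theorem F₁_stable : ∀ x ∈ F₁, T₁ x ∈ F₁ := by
  rintro ⟨a, b⟩ h
  rw [mem_F₁] at h ⊢
  simp only at h
  subst h
  simp

/-- `F₁ ≠ 0`. [this sketch] -/
theorem F₁_ne_bot : F₁ ≠ ⊥ := by
  intro h
  have hmem : ((0 : ℤ), (1 : ZMod 2)) ∈ F₁ := (mem_F₁ _).mpr rfl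
  rw [h, AddSubgroup.mem_bot, Prod.mk_eq_zero] at hmem
  exact absurd hmem.2 (by decide)

/-- `F₁` is finite (it injects into `ZMod 2`). [this sketch] -/
theorem finite_F₁ : Finite F₁ := by
  refine Finite.of_injective (fun x : F₁ ↦ (x : ℤ × ZMod 2).2) ?_
  rintro ⟨⟨a, b⟩, ha⟩ ⟨⟨a', b'⟩, ha'⟩ h
  have h1 : a = 0 := (mem_F₁ _).mp ha
  have h2 : a' = 0 := (mem_F₁ _).mp ha'
  subst h1 h2
  simp only at h
  subst h
  rfl

/-- `φ₀`-SHADOW IS ONE, NOT ZERO: `X₁[T] ∋ ε ≠ 0` (so the `Γ`-invariants of the dual / the coinvariants `𝔖_Γ` are non-trivial).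
[this sketch] -/
theorem shadow_ker_ne_bot : T₁.ker ≠ ⊥ := by
  intro h
  have hmem : ((0 : ℤ), (1 : ZMod 2)) ∈ T₁.ker := by
    rw [AddMonoidHom.mem_ker, T₁_apply]
    simp
  rw [h, AddSubgroup.mem_bot, Prod.mk_eq_zero] at hmem
  exact absurd hmem.2 (by decide)

/-- **R93 (b) / R90-CYC refuted by one module (packaged).** A cyclic (`shadow_cyclic`, residual dimension one
`shadow_residual_ker`), torsion (`shadow_torsion`), finite-control (`shadow_four_mul_mem_range`) `ℤ[T]`-module WITH a non-zero
finite `T`-stable subgroup and non-zero `T`-invariants. [this sketch] -/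
theorem cyclic_torsion_finiteControl_with_finite_submodule :
    (∀ x : ℤ × ZMod 2, ∃ a b : ℤ, x = a • ((1 : ℤ), (0 : ZMod 2)) + b • T₁ (1, 0)) ∧
    (∀ x : ℤ × ZMod 2, T₁ (T₁ x + 2 • x) + 2 • (T₁ x + 2 • x) = 0) ∧
    (∀ x : ℤ × ZMod 2, 4 • x ∈ T₁.range) ∧
    (∃ F : AddSubgroup (ℤ × ZMod 2), F ≠ ⊥ ∧ Finite F ∧ ∀ x ∈ F, T₁ x ∈ F) ∧
    T₁.ker ≠ ⊥ :=
  ⟨shadow_cyclic, shadow_torsion,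
    fun x ↦ by obtain ⟨a, b⟩ := x; rw [shadow_four_nsmul_eq]; exact shadow_four_mul_mem_range a,
    ⟨F₁, F₁_ne_bot, finite_F₁, F₁_stable⟩, shadow_ker_ne_bot⟩

end Shadow

/-! ## §C. The twin `X₂ = ℤ`, `T = ·(−4)` (shadow of `Λ ⧸ (T+4)`): same level-0 data, `φ₀ = 0` -/

section Twin

/-- `T` on the twin. [this sketch] -/
def T₂ : ℤ →+ ℤ := AddMonoidHom.mulLeft (-4 : ℤ)

@[simp] theorem T₂_apply (a : ℤ) : T₂ a = -4 * a := rfl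

/-- control quotient of order exactly 4 again: `4ℤ ⊆ T₂ ℤ`, `2 ∉ T₂ ℤ` (and `ℤ` is cyclic, residual dimension `dim ℤ/(2,T₂)ℤ = 1`). -/
theorem twin_four_mul_mem_range (a : ℤ) : 4 * a ∈ T₂.range := ⟨-a, by rw [T₂_apply]; ring⟩

theorem twin_two_not_mem_range : (2 : ℤ) ∉ T₂.range := by
  rintro ⟨c, h⟩
  rw [T₂_apply] at h
  omega

theorem twin_residual (a : ℤ) : (a : ZMod 2) = 0 ↔ ∃ y z : ℤ, a = 2 * y + T₂ z := by
  rw [ZMod.intCast_zmod_eq_zero_iff_dvd]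
  constructor
  · rintro ⟨a', rfl⟩
    exact ⟨a', 0, by rw [T₂_apply]; ring⟩
  · rintro ⟨y, z, h⟩
    rw [T₂_apply] at h
    exact ⟨y - 2 * z, by rw [h]; ring⟩

/-- … but NO non-zero finite (`T`-stable or not) subgroup … [this sketch] -/
theorem twin_noFinite (H : AddSubgroup ℤ) (hH : Finite H) : H = ⊥ := by
  rw [eq_bot_iff]
  intro x hx
  rw [AddSubgroup.mem_bot]
  have hfin : IsOfFinAddOrder (⟨x, hx⟩ : H) := isOfFinAddOrder_of_finite _
  rw [isOfFinAddOrder_iff_nsmul_eq_zero] at hfin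
  obtain ⟨n, hn, hnx⟩ := hfin
  have hnx' : (n : ℤ) * x = 0 := by
    have := congrArg (fun y : H ↦ (y : ℤ)) hnx
    simpa [nsmul_eq_mul] using this
  rcases mul_eq_zero.mp hnx' with h | h
  · omega
  · exact h

/-- … and `X₂[T] = 0`: the `φ₀`-shadow is ZERO. Together with §B: `φ₀` is not a function of (cyclicity, residual dimension,
`#X/TX`, `λ`, `μ`). [this sketch] -/
theorem twin_ker_eq_bot : T₂.ker = ⊥ := by
  rw [eq_bot_iff]
  intro x hx
  rw [AddMonoidHom.mem_ker, T₂_apply] at hx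
  rw [AddSubgroup.mem_bot]
  omega

end Twin

/-! ## §D. The re-cut of the anchor package: STRUCT (`φ₀ = 0`) ∧ EXHIBIT (constructive lower bounds) ⟹ `Δ₀ ≤ 1`

Variables as in k1-g10 `armM_member_bound`: anchor digits `b₀ c₀ φ₀ kk₀`, member tables `t k`, anchor Ш-digit `B₀`, slacks
`β₀ := B₀ + t − b₀`, `κ₀ := k − c₀`, `Δ₀ := φ₀ + kk₀ + β₀ + κ₀`; NEW: `bl`, `cl` = numbers of independent classes EXHIBITED in
`𝔖_{v̄}(K₀, W₀*)` resp. in the control cokernel (R89 (i)/(ii)) — LOWER bounds only. -/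

section Recut

/-- **`Δ₀ ≤ 1` from the structural digit and the exhibits.** No hypothesis bounds `b₀` or `c₀` from ABOVE: the bounding
(local-image) half of a descent at `W₀` is not consumed. [this sketch] -/
theorem delta0_le_one_of_struct_exhibit {φ₀ kk₀ β₀ κ₀ b₀ c₀ B₀ t k bl cl : ℤ}
    (hφ : φ₀ = 0) (hkk : kk₀ = 0) (hβ₀ : b₀ + β₀ = B₀ + t) (hκ₀ : c₀ + κ₀ = k)
    (hb : bl ≤ b₀) (hc : cl ≤ c₀) (htab : B₀ + t + k ≤ bl + cl + 1) :
    φ₀ + kk₀ + β₀ + κ₀ ≤ 1 := by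
  omega

/-- Sharp form: exhibits filling the tables exactly give `Δ₀ = 0` (the one-sided table bounds hold at the anchor too, so
`β₀, κ₀ ≥ 0`). [this sketch] -/
theorem delta0_eq_zero_of_struct_exhibit {φ₀ kk₀ β₀ κ₀ b₀ c₀ B₀ t k bl cl : ℤ}
    (hφ : φ₀ = 0) (hkk : kk₀ = 0) (hβ₀ : b₀ + β₀ = B₀ + t) (hκ₀ : c₀ + κ₀ = k)
    (hbot₀ : b₀ ≤ B₀ + t) (hcok₀ : c₀ ≤ k)
    (hb : bl ≤ b₀) (hc : cl ≤ c₀) (htab : B₀ + t + k ≤ bl + cl) :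
    φ₀ + kk₀ + β₀ + κ₀ = 0 := by
  omega

/-- Conversely a structural digit `φ₀ ≥ 1` (the §B shape at the anchor) costs the whole slack budget of arm M′:
then `Δ₀ ≤ 1` forces `β₀ = κ₀ = kk₀ = 0`. [this sketch] -/
theorem budget_spent_of_phi0_pos {φ₀ kk₀ β₀ κ₀ : ℤ} (hφ : 1 ≤ φ₀) (hkk : 0 ≤ kk₀) (hβ : 0 ≤ β₀) (hκ : 0 ≤ κ₀)
    (hΔ : φ₀ + kk₀ + β₀ + κ₀ ≤ 1) : φ₀ = 1 ∧ kk₀ = 0 ∧ β₀ = 0 ∧ κ₀ = 0 := by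
  omega

/-- THE ONE VALID RESIDUE OF R90: if the bounding descent returns residual dimension ZERO (`𝔖^Γ[2] = 0`, i.e. `b₀ = c₀ = 0`,
so `X(W₀) = 0` by Nakayama and `φ₀ = 0` for free), the anchor sits `B₀ + t + k` below the member tables — compatible with the
budget `Δ₀ ≤ 1` only on keys with `B₀ + t + k ≤ 1`. [this sketch] -/
theorem dimZero_anchor_budget {φ₀ kk₀ β₀ κ₀ b₀ c₀ B₀ t k : ℤ}
    (hb0 : b₀ = 0) (hc0 : c₀ = 0) (hβ₀ : b₀ + β₀ = B₀ + t) (hκ₀ : c₀ + κ₀ = k) (hφ : 0 ≤ φ₀) (hkk : 0 ≤ kk₀)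
    (hΔ : φ₀ + kk₀ + β₀ + κ₀ ≤ 1) : B₀ + t + k ≤ 1 := by
  omega

/-- EXHIBIT → DIGIT: an injective additive map from a group of order `p^r` into a finite group `G` gives `r ≤ v_p #G`.
[folklore: Lagrange] -/
theorem le_padicValNat_card_of_injective {A G : Type*} [AddGroup A] [AddGroup G] [Finite G]
    (f : A →+ G) (hf : Function.Injective f) {p r : ℕ} [Fact p.Prime] (hA : Nat.card A = p ^ r) :
    r ≤ padicValNat p (Nat.card G) := by
  have hdvd : Nat.card A ∣ Nat.card G := AddSubgroup.card_dvd_of_injective f hf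
  rw [hA] at hdvd
  exact (padicValNat_dvd_iff_le (Nat.card_pos (α := G)).ne').mp hdvd

/-- EXHIBIT → DIGIT, two independent families (point classes `2^{-j}P₀`, `j ≤ ℓ₀`, and torsion / Ш-classes): subgroups
`A, B ≤ G` of orders `p^r`, `p^s` with `A ⊓ B = ⊥` give `r + s ≤ v_p #G`. [folklore] -/
theorem add_le_padicValNat_card_of_disjoint {G : Type*} [AddCommGroup G] [Finite G]
    (A B : AddSubgroup G) (hAB : Disjoint A B) {p r s : ℕ} [Fact p.Prime]
    (hA : Nat.card A = p ^ r) (hB : Nat.card B = p ^ s) :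
    r + s ≤ padicValNat p (Nat.card G) := by
  let f : A × B →+ G := (AddSubgroup.subtype A).coprod (AddSubgroup.subtype B)
  have hf : Function.Injective f := by
    rw [injective_iff_map_eq_zero]
    rintro ⟨⟨a, ha⟩, ⟨b, hb⟩⟩ h
    simp only [f, AddMonoidHom.coprod_apply, AddSubgroup.coe_subtype] at h
    have hab : a = -b := eq_neg_of_add_eq_zero_left h
    have haB : a ∈ B := hab ▸ B.neg_mem hb
    have ha0 : a = 0 := AddSubgroup.disjoint_def.mp hAB ha haB
    have hb0 : b = 0 := by rw [ha0, zero_add] at h; exact h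
    subst ha0 hb0
    rfl
  have hcard : Nat.card (A × B) = p ^ (r + s) := by rw [Nat.card_prod, hA, hB, pow_add]
  exact le_padicValNat_card_of_injective f hf hcard

end Recut

end Summit.BirchSwinnertonDyer.BirchSwinnertonDyer.Cruxes.SplitBadTwoLowerHalfOfFacts.StubIdeasK3G12
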